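import Mathlib
import Literature.AlgebraicGeometry.Resolution.FormalCoordinateChange
import Literature.AlgebraicGeometry.Resolution.FormalInverseFunction
import Literature.AlgebraicGeometry.Resolution.WeightedShear
import Summits.ResolutionOfSingularities.ResolutionOfSingularities.Theorems.WeightedInvariantGlobalizeLocalDropCanonize

/-!
# Prepared maximal-contact coordinates for plane germs (crux `LocalWeightedDrop`)

Crux `LocalWeightedDrop` (stmt-ResolutionOfSingularities-8899, route
ResolutionOfSingularities/WeightedInvariant), line `hasse-ridge-face-selection`, registered stub
`stub_prepareContact` of the skeleton `LocalWeightedDrop` (plane case `n = 2` of the local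
weighted resolution game; its output is consumed by `stub_faceDropPlane`).

For `f ∈ k[[x, y]]` (`x = X 0`, `y = X 1`, `k` an infinite field) of order `d ≥ 1`, "contact
`≥ N`" in the legal formal coordinates `Φ` (zero constant terms, invertible linear part) means
that the `(1, N)`-weighted order of `g = f ∘ Φ := subst Φ f` is `≥ N d`.  The `(1, N)`-initial
coefficients of `g` are `a_j = coeff (N (d - j), j) g`, `j ≤ d`.  The statement: from SOME
coordinates with contact `≥ N ≥ 1` one gets coordinates with contact `≥ N`, order still `d`,
`a_d = coeff y^d ≠ 0`, and such that `(a_j)_j` is not the coefficient vector of a pure power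
`β (y - a xᴺ)^d` with `a ≠ 0`.

Proof (the weighted bookkeeping — initial parts, the shifts `σ_a = (x, y + a xᴺ)`, the linear
maps `τ_c = (x + c y, y)`, order preservation and composition of legal changes — is the
folklore file `Literature/AlgebraicGeometry/Resolution/WeightedShear.lean`):
* ORDER: legal coordinate changes preserve the order (`WeightedShear.order_subst_of_isUnit_det`).
* `a_d ≠ 0`: for `N ≥ 2` this is automatic (`coeff_single_ne_zero_of_two_le`: every other
  exponent of degree `d` has weight `< N d`, so `a_d = 0` would force `ord g > d`); for `N = 1`
  the `y^d`-coefficient of `g ∘ τ_c` is the non-zero polynomial `∑_j a_j c^{d-j}` in `c`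
  (`WeightedShear.coeff_subst_linear`), which has a non-root since `k` is infinite
  (`exists_linear_coeff_ne_zero`); replace `Φ` by `Φ ∘ τ_c` (`WeightedShear.comp_step`).
* NOT A PURE POWER: if `a_j = β C(d,j) (-a)^{d-j}` for all `j ≤ d` (`a ≠ 0`, so `β = a_d ≠ 0`),
  replace `Φ` by `Φ ∘ σ_a`: the new initial coefficients are `a'_d = β`, `a'_j = 0` for `j < d`
  (`WeightedShear.coeff_subst_shift_of_pure_power`, the binomial theorem), which is not of the
  form `β' C(d,j) (-a')^{d-j}` with `a' ≠ 0` (look at `j = d` if `β' = 0`, at `j = 0` otherwise).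
-/

set_option linter.dupNamespace false -- mandated namespace of this single-conjunct summit

namespace Summit.ResolutionOfSingularities.ResolutionOfSingularities.Theorems

open Literature.AlgebraicGeometry.Resolution

namespace PrepareContact

variable {k : Type} [Field k]

/-- For `N ≥ 2`, contact `≥ N` and order `d` force `a_d = coeff y^d ≠ 0`: every other exponent
`(i, j)` of degree `d` has `(1, N)`-weight `i + N j < N d`. -/
theorem coeff_single_ne_zero_of_two_le {N d : ℕ} (hN : 2 ≤ N) {g : MvPowerSeries (Fin 2) k}
    (hgd : g.order = d) (hg : ((N * d : ℕ) : ℕ∞) ≤ MvPowerSeries.weightedOrder ![1, N] g) :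
    MvPowerSeries.coeff (Finsupp.single 1 d) g ≠ 0 := by
  intro h0
  have h1 : ((d + 1 : ℕ) : ℕ∞) ≤ g.order := by
    apply MvPowerSeries.nat_le_order
    intro e he
    rcases (Nat.lt_succ_iff.mp he).lt_or_eq with hlt | heq
    · exact MvPowerSeries.coeff_of_lt_order (by rw [hgd]; exact_mod_cast hlt)
    · by_cases he1 : e = Finsupp.single 1 d
      · rw [he1]
        exact h0
      · refine MvPowerSeries.coeff_eq_zero_of_lt_weightedOrder _ (lt_of_lt_of_le ?_ hg)
        rw [WeightedShear.weight_fin_two, one_mul]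
        rw [Finsupp.degree_eq_sum, Fin.sum_univ_two] at heq
        have he1' : e 1 < d := by
          by_contra hge
          apply he1
          ext i
          fin_cases i <;> simp <;> omega
        have h4 : N * e 0 + N * e 1 = N * d := by rw [← Nat.mul_add, heq]
        have h5 : 2 * e 0 ≤ N * e 0 := Nat.mul_le_mul_right (e 0) hN
        exact_mod_cast (show e 0 + N * e 1 < N * d by omega)
  rw [hgd] at h1
  exact absurd (by exact_mod_cast h1 : d + 1 ≤ d) (by omega)

/-- For `N = 1` over an infinite field: some linear map `τ_c = (x + c y, y)` makes the
`y^d`-coefficient of `g ∘ τ_c` non-zero (`g` of order `d`). -/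
theorem exists_linear_coeff_ne_zero [Infinite k] {d : ℕ} {g : MvPowerSeries (Fin 2) k}
    (hgd : g.order = d) (hg : ((1 * d : ℕ) : ℕ∞) ≤ MvPowerSeries.weightedOrder ![1, 1] g) :
    ∃ c : k, MvPowerSeries.coeff (Finsupp.single 1 d)
      (MvPowerSeries.subst ![MvPowerSeries.X 0 + MvPowerSeries.C c * MvPowerSeries.X 1,
        MvPowerSeries.X 1] g : MvPowerSeries (Fin 2) k) ≠ 0 := by
  have hc : ∃ j ∈ Finset.range (d + 1),
      MvPowerSeries.coeff (Finsupp.single 0 (1 * (d - j)) + Finsupp.single 1 j) g ≠ 0 := by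
    have hfin : g.order.toNat = g.order := by rw [hgd, ENat.toNat_coe]
    obtain ⟨e, he, hdeg⟩ := MvPowerSeries.exists_coeff_ne_zero_and_order hfin
    rw [hgd, Nat.cast_inj, Finsupp.degree_eq_sum, Fin.sum_univ_two] at hdeg
    refine ⟨e 1, Finset.mem_range.mpr (by omega), ?_⟩
    have hee : Finsupp.single 0 (1 * (d - e 1)) + Finsupp.single 1 (e 1) = e := by
      ext i
      fin_cases i <;> simp
      omega
    rwa [hee]
  obtain ⟨c, hc⟩ := WeightedShear.exists_sum_mul_pow_ne_zero _ hc
  exact ⟨c, by rwa [WeightedShear.coeff_subst_linear hg]⟩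

end PrepareContact

/-- PREPARED MAXIMAL-CONTACT COORDINATES (plane germs over an infinite field).  If `f` of order
`d ≥ 1` has contact `≥ N ≥ 1` in some formal coordinates, then it has contact `≥ N` in formal
coordinates `Φ` which are moreover NORMALISED: the `y^d`-coefficient of `g = f∘Φ` is non-zero (so the
`(1,N)`-initial form of `g` is `P(xᴺ, y)` for a binary form `P` of degree `d` with `P(0,1) ≠ 0`), and the
initial form is not `β·(y − a·xᴺ)^d` for any `a ≠ 0` (if it is a `d`-th power of a linear form in
`(xᴺ, y)` then it is `β·y^d`: shift `y ↦ y + a xᴺ`; for `N = 1` first a linear change making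
`P(0,1) ≠ 0`).  The order is unchanged. -/
theorem stub_prepareContact : ∀ (k : Type) [Field k] [Infinite k] (f : MvPowerSeries (Fin 2) k) (d N : ℕ),
    f.order = d → 1 ≤ d → 1 ≤ N →
    (∃ Φ : Fin 2 → MvPowerSeries (Fin 2) k, (∀ i, MvPowerSeries.constantCoeff (Φ i) = 0) ∧
      IsUnit (Matrix.det (Matrix.of fun i j => MvPowerSeries.coeff (Finsupp.single j 1) (Φ i))) ∧
      ((N * d : ℕ) : ℕ∞) ≤ MvPowerSeries.weightedOrder ![1, N] (MvPowerSeries.subst Φ f)) →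
    ∃ Φ : Fin 2 → MvPowerSeries (Fin 2) k, (∀ i, MvPowerSeries.constantCoeff (Φ i) = 0) ∧
      IsUnit (Matrix.det (Matrix.of fun i j => MvPowerSeries.coeff (Finsupp.single j 1) (Φ i))) ∧
      (MvPowerSeries.subst Φ f).order = d ∧
      ((N * d : ℕ) : ℕ∞) ≤ MvPowerSeries.weightedOrder ![1, N] (MvPowerSeries.subst Φ f) ∧
      MvPowerSeries.coeff (Finsupp.single 1 d) (MvPowerSeries.subst Φ f) ≠ 0 ∧
      ∀ (a β : k), a ≠ 0 → ∃ j, j ≤ d ∧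
        MvPowerSeries.coeff (Finsupp.single 0 (N * (d - j)) + Finsupp.single 1 j) (MvPowerSeries.subst Φ f) ≠
          β * (d.choose j : k) * (-a) ^ (d - j) := by
  intro k _ _ f d N hfd hd hN hex
  obtain ⟨Φ₀, hΦ₀0, hΦ₀det, hΦ₀w⟩ := hex
  -- STEP 1: coordinates `Φ₁` with contact `≥ N` and `a_d ≠ 0`
  obtain ⟨Φ₁, hΦ₁0, hΦ₁det, hΦ₁w, hΦ₁c⟩ : ∃ Φ₁ : Fin 2 → MvPowerSeries (Fin 2) k,
      (∀ i, MvPowerSeries.constantCoeff (Φ₁ i) = 0) ∧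
      IsUnit (FormalCoordChange.linMat Φ₁).det ∧
      ((N * d : ℕ) : ℕ∞) ≤ MvPowerSeries.weightedOrder ![1, N] (MvPowerSeries.subst Φ₁ f) ∧
      MvPowerSeries.coeff (Finsupp.single 1 d) (MvPowerSeries.subst Φ₁ f) ≠ 0 := by
    rcases (show N = 1 ∨ 2 ≤ N by omega) with rfl | hN2
    · obtain ⟨c, hc⟩ := PrepareContact.exists_linear_coeff_ne_zero
        ((WeightedShear.order_subst_of_isUnit_det hΦ₀0 hΦ₀det f).trans hfd) hΦ₀w
      obtain ⟨h0', hdet', hw', hcomp⟩ := WeightedShear.comp_step hΦ₀0 hΦ₀det hΦ₀w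
        (WeightedShear.constantCoeff_linear c)
        (by unfold FormalCoordChange.linMat; rw [WeightedShear.det_linMat_linear]; exact isUnit_one)
        (WeightedShear.one_le_weightedOrder_linear c)
        (by exact_mod_cast WeightedShear.le_weightedOrder_X_one (k := k) 1)
      exact ⟨_, h0', hdet', hw', by rwa [hcomp]⟩
    · exact ⟨Φ₀, hΦ₀0, hΦ₀det, hΦ₀w, PrepareContact.coeff_single_ne_zero_of_two_le hN2
        ((WeightedShear.order_subst_of_isUnit_det hΦ₀0 hΦ₀det f).trans hfd) hΦ₀w⟩
  -- STEP 2: if the initial form of `g = f ∘ Φ₁` is a pure power `β (y - a xᴺ)^d`, shift by `σ_a`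
  set g : MvPowerSeries (Fin 2) k := MvPowerSeries.subst Φ₁ f
  by_cases hpp : ∃ a β : k, a ≠ 0 ∧ ∀ j ∈ Finset.range (d + 1),
      MvPowerSeries.coeff (Finsupp.single 0 (N * (d - j)) + Finsupp.single 1 j) g =
        β * (d.choose j : k) * (-a) ^ (d - j)
  · obtain ⟨a, β, -, hall⟩ := hpp
    have hβ : β ≠ 0 :=
      (by simpa using hall d (Finset.self_mem_range_succ d) :
        MvPowerSeries.coeff (Finsupp.single 1 d) g = β) ▸ hΦ₁c
    obtain ⟨σ, hσ0, hσdet, hσw0, hσw1, hkey⟩ : ∃ σ : Fin 2 → MvPowerSeries (Fin 2) k,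
        (∀ i, MvPowerSeries.constantCoeff (σ i) = 0) ∧ IsUnit (FormalCoordChange.linMat σ).det ∧
        (1 : ℕ∞) ≤ MvPowerSeries.weightedOrder ![1, N] (σ 0) ∧
        (N : ℕ∞) ≤ MvPowerSeries.weightedOrder ![1, N] (σ 1) ∧
        ∀ j, j ≤ d → MvPowerSeries.coeff (Finsupp.single 0 (N * (d - j)) + Finsupp.single 1 j)
          (MvPowerSeries.subst σ g) = if j = d then β else 0 :=
      ⟨![MvPowerSeries.X 0, MvPowerSeries.X 1 + MvPowerSeries.C a * MvPowerSeries.X 0 ^ N],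
        WeightedShear.constantCoeff_shift hN a,
        by unfold FormalCoordChange.linMat; rw [WeightedShear.det_linMat_shift]; exact isUnit_one,
        WeightedShear.one_le_weightedOrder_X_zero N, WeightedShear.le_weightedOrder_shift N a,
        fun j hj => WeightedShear.coeff_subst_shift_of_pure_power hN hΦ₁w hall hj⟩
    obtain ⟨h0', hdet', hw', hcomp⟩ := WeightedShear.comp_step hΦ₁0 hΦ₁det hΦ₁w hσ0 hσdet hσw0 hσw1
    have hkey_d : MvPowerSeries.coeff (Finsupp.single 1 d) (MvPowerSeries.subst σ g) = β := by
      simpa using hkey d le_rfl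
    refine ⟨fun i => MvPowerSeries.subst σ (Φ₁ i), h0', hdet',
      (WeightedShear.order_subst_of_isUnit_det h0' hdet' f).trans hfd, hw', ?_, ?_⟩
    · rw [hcomp, hkey_d]
      exact hβ
    · intro a' β' ha'
      rw [hcomp]
      by_cases hβ' : β' = 0
      · refine ⟨d, le_rfl, ?_⟩
        rw [hkey d le_rfl, if_pos rfl, hβ', zero_mul, zero_mul]
        exact hβ
      · refine ⟨0, Nat.zero_le d, ?_⟩
        rw [hkey 0 (Nat.zero_le d), if_neg (by omega), Nat.sub_zero, Nat.choose_zero_right,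
          Nat.cast_one, mul_one]
        exact (mul_ne_zero hβ' (pow_ne_zero d (neg_ne_zero.mpr ha'))).symm
  · push Not at hpp
    refine ⟨Φ₁, hΦ₁0, hΦ₁det, (WeightedShear.order_subst_of_isUnit_det hΦ₁0 hΦ₁det f).trans hfd,
      hΦ₁w, hΦ₁c, fun a β ha => ?_⟩
    obtain ⟨j, hj, hne⟩ := hpp a β ha
    exact ⟨j, Nat.lt_succ_iff.mp (Finset.mem_range.mp hj), hne⟩

end Summit.ResolutionOfSingularities.ResolutionOfSingularities.Theorems
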